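import Summits.AtomisticToContinuum.Crystallization.Theorems.ExcessDecayLiouvilleSiteGeometry
import Summits.AtomisticToContinuum.Crystallization.Theorems.ExcessDecayLiouvilleFarField

/-!
# Route `ExcessDecayLiouville`: the second-variation lattice sums are honest (summability)

The harmonic-stability hypothesis shared by `PhononStability`, `HcpLiouville` and `ExcessDecay`
(stmt-AtomisticToContinuum-9333/9332/9334) is an inequality between two iterated `tsum`s over the site set
`S = Sites₀ t A` of an admissible datum,
`κ · Σ'_p Σ'_q [|p−q| ≤ 11/10] ‖u p − u q‖² ≤ ½ Σ'_p Σ'_q [p ≠ q] Hess₀ (p − q) (u p − u q)`,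
for finitely supported displacements `u`.  Before either side can be manipulated (split into finite sums
plus tails, compared with a Bloch/Fourier expression, fed with test displacements in an excess-decay
argument) one must know that the families ARE summable, so that `tsum` is the true value and not the junk
`0`.  This file proves it from the uniform discreteness of `S` (`dist_sites_ge`: distinct sites are
`≥ 23/25` apart under `Adm₀ A`, `Inner₀ t A`) and the far-field bound of
`ExcessDecayLiouvilleFarField.lean`:

* `Hess₀_smul_right`, `abs_Hess₀_le'` : `wᵀK(e)w` is quadratic in `w` and `|wᵀK(e)w| ≤ 904 |e|⁻⁸ ‖w‖²`
  for `|e| ≥ 1/2`;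
* `summable_inv_pow_eight_sites` : `q ↦ |q − p|⁻⁸` (`q ≠ p`) is summable over `S` for `p ∈ S`;
* `summable_hessRow` : for each site `p`, the inner family `q ↦ [p ≠ q] Hess₀ (p−q) (u p − u q)` is summable;
* `summable_hessRows` : the outer family `p ↦ Σ'_q …` is summable;
* `summable_nnRow`, `summable_nnRows` : the same for the nearest-neighbour strain form (finite supports).

All `[folklore]`; helper lemmas, nothing here closes an item.
-/

noncomputable section

namespace Summit.AtomisticToContinuum.Crystallization.Theorems.ExcessDecayLiouville

open scoped BigOperators Topology InnerProductSpace
open Literature.MathematicalPhysics.StatisticalMechanics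
open Summit.AtomisticToContinuum.Crystallization.Theorems.PhononStabilityNegative

/-! ## The force-constant form is quadratic and `O(|e|⁻⁸)` -/

/-- `K(e)` is a quadratic form in the displacement: `Hess₀ e (a • w) = a² · Hess₀ e w`. [folklore] -/
theorem Hess₀_smul_right (e w : (EuclideanSpace ℝ (Fin 3))) (a : ℝ) : Hess₀ e (a • w) = a ^ 2 * Hess₀ e w := by
  simp only [Hess₀, real_inner_smul_right, norm_smul, Real.norm_eq_abs, mul_pow, sq_abs]
  ring

/-- `|wᵀK(e)w| ≤ 904 · |e|⁻⁸ · ‖w‖²` for `|e| ≥ 1/2` (from `abs_Hess₀_le_inv_pow` by scaling). [folklore] -/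
theorem abs_Hess₀_le' {e : (EuclideanSpace ℝ (Fin 3))} (he : (1 / 2 : ℝ) ≤ ‖e‖) (w : (EuclideanSpace ℝ (Fin 3))) :
    |Hess₀ e w| ≤ 904 * (‖e‖⁻¹) ^ 8 * ‖w‖ ^ 2 := by
  by_cases hw : w = 0
  · subst hw; simp
  · have hn : ‖w‖ ≠ 0 := norm_ne_zero_iff.2 hw
    set w₁ : (EuclideanSpace ℝ (Fin 3)) := ‖w‖⁻¹ • w with hw₁def
    have hw₁ : ‖w₁‖ = 1 := by rw [hw₁def, norm_smul, norm_inv, norm_norm, inv_mul_cancel₀ hn]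
    have hw' : w = ‖w‖ • w₁ := by rw [hw₁def, smul_smul, mul_inv_cancel₀ hn, one_smul]
    have h1 : Hess₀ e w = ‖w‖ ^ 2 * Hess₀ e w₁ := by
      conv_lhs => rw [hw']
      rw [Hess₀_smul_right]
    rw [h1, abs_mul, abs_of_nonneg (sq_nonneg _)]
    have h2 := abs_Hess₀_le_inv_pow he hw₁
    have h3 : 0 ≤ ‖w‖ ^ 2 := sq_nonneg _
    calc ‖w‖ ^ 2 * |Hess₀ e w₁| ≤ ‖w‖ ^ 2 * (904 * (‖e‖⁻¹) ^ 8) := mul_le_mul_of_nonneg_left h2 h3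
      _ = 904 * (‖e‖⁻¹) ^ 8 * ‖w‖ ^ 2 := by ring

section Sites

variable {t : Fin 2 → (EuclideanSpace ℝ (Fin 3))} {A : (EuclideanSpace ℝ (Fin 3)) →L[ℝ] (EuclideanSpace ℝ (Fin 3))}

/-- **`|q − p|⁻⁸` is summable over the site set** (`q ≠ p`, `p` a site): the sites are `23/25`-separated,
so the far-field bound applies with `δ = R = 23/25`, `k = 5`. [folklore] -/
theorem summable_inv_pow_eight_sites (hA : Adm₀ A) (hI : Inner₀ t A) {p : (EuclideanSpace ℝ (Fin 3))} (hp : p ∈ Sites₀ t A) :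
    Summable (fun q : Sites₀ t A => if (q : (EuclideanSpace ℝ (Fin 3))) ≠ p then (dist (q : (EuclideanSpace ℝ (Fin 3))) p)⁻¹ ^ 8 else 0) := by
  classical
  refine summable_of_sum_le (fun q => by split_ifs <;> positivity)
    (c := 1024 / ((23 / 25 : ℝ) ^ 3 * (23 / 25 : ℝ) ^ 5)) fun u => ?_
  have hsum : ∑ q ∈ u, (if (q : (EuclideanSpace ℝ (Fin 3))) ≠ p then (dist (q : (EuclideanSpace ℝ (Fin 3))) p)⁻¹ ^ 8 else 0) =
      ∑ a ∈ (u.map (Function.Embedding.subtype _)).filter (· ≠ p), (dist a p)⁻¹ ^ (5 + 3) := by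
    rw [Finset.sum_filter, Finset.sum_map]
    rfl
  rw [hsum]
  refine sum_inv_pow_le_of_separated _ p (by norm_num) (by norm_num) le_rfl ?_ ?_
  · intro a ha b hb hab
    simp only [Finset.mem_filter, Finset.mem_map, Function.Embedding.coe_subtype] at ha hb
    obtain ⟨⟨a', -, rfl⟩, -⟩ := ha
    obtain ⟨⟨b', -, rfl⟩, -⟩ := hb
    exact dist_sites_ge hA hI a'.2 b'.2 hab
  · intro a ha
    simp only [Finset.mem_filter, Finset.mem_map, Function.Embedding.coe_subtype] at ha
    obtain ⟨⟨a', -, rfl⟩, ha2⟩ := ha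
    exact dist_sites_ge hA hI a'.2 hp ha2

/-- One frozen row: `q ↦ [p ≠ q] Hess₀ (p − q) w` is summable over the sites for a site `p`. [folklore] -/
theorem summable_hess_frozen (hA : Adm₀ A) (hI : Inner₀ t A) (p : Sites₀ t A) (w : (EuclideanSpace ℝ (Fin 3))) :
    Summable (fun q : Sites₀ t A => if (p : (EuclideanSpace ℝ (Fin 3))) ≠ q then Hess₀ ((p : (EuclideanSpace ℝ (Fin 3))) - q) w else 0) := by
  classical
  refine Summable.of_norm_bounded
    ((summable_inv_pow_eight_sites hA hI p.2).mul_left (904 * ‖w‖ ^ 2)) fun q => ?_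
  by_cases hq : (p : (EuclideanSpace ℝ (Fin 3))) = q
  · simp [hq]
  · have hne : (q : (EuclideanSpace ℝ (Fin 3))) ≠ p := fun h => hq h.symm
    rw [if_pos hq, if_pos hne, Real.norm_eq_abs]
    have hd : (23 / 25 : ℝ) ≤ dist (p : (EuclideanSpace ℝ (Fin 3))) q := dist_sites_ge hA hI p.2 q.2 hq
    have he : (1 / 2 : ℝ) ≤ ‖(p : (EuclideanSpace ℝ (Fin 3))) - q‖ := by rw [← dist_eq_norm]; linarith
    calc |Hess₀ ((p : (EuclideanSpace ℝ (Fin 3))) - q) w| ≤ 904 * (‖(p : (EuclideanSpace ℝ (Fin 3))) - q‖⁻¹) ^ 8 * ‖w‖ ^ 2 := abs_Hess₀_le' he w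
      _ = 904 * ‖w‖ ^ 2 * (dist (q : (EuclideanSpace ℝ (Fin 3))) p)⁻¹ ^ 8 := by rw [dist_comm, dist_eq_norm]; ring

/-- One frozen column: `p ↦ [p ≠ q] Hess₀ (p − q) w` is summable over the sites for a site `q`. [folklore] -/
theorem summable_hess_frozen' (hA : Adm₀ A) (hI : Inner₀ t A) (q : Sites₀ t A) (w : (EuclideanSpace ℝ (Fin 3))) :
    Summable (fun p : Sites₀ t A => if (p : (EuclideanSpace ℝ (Fin 3))) ≠ q then Hess₀ ((p : (EuclideanSpace ℝ (Fin 3))) - q) w else 0) := by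
  classical
  refine Summable.of_norm_bounded
    ((summable_inv_pow_eight_sites hA hI q.2).mul_left (904 * ‖w‖ ^ 2)) fun p => ?_
  by_cases hq : (p : (EuclideanSpace ℝ (Fin 3))) = q
  · simp [hq]
  · rw [if_pos hq, if_pos hq, Real.norm_eq_abs]
    have hd : (23 / 25 : ℝ) ≤ dist (p : (EuclideanSpace ℝ (Fin 3))) q := dist_sites_ge hA hI p.2 q.2 hq
    have he : (1 / 2 : ℝ) ≤ ‖(p : (EuclideanSpace ℝ (Fin 3))) - q‖ := by rw [← dist_eq_norm]; linarith
    calc |Hess₀ ((p : (EuclideanSpace ℝ (Fin 3))) - q) w| ≤ 904 * (‖(p : (EuclideanSpace ℝ (Fin 3))) - q‖⁻¹) ^ 8 * ‖w‖ ^ 2 := abs_Hess₀_le' he w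
      _ = 904 * ‖w‖ ^ 2 * (dist (p : (EuclideanSpace ℝ (Fin 3))) q)⁻¹ ^ 8 := by rw [dist_eq_norm]; ring

/-- The sites carrying a nonzero displacement form a finite set when `u` is finitely supported. [folklore] -/
theorem finite_support_sites {u : (EuclideanSpace ℝ (Fin 3)) → (EuclideanSpace ℝ (Fin 3))} (hu : (Function.support u).Finite) :
    Set.Finite {q : Sites₀ t A | u q ≠ 0} :=
  (hu.preimage Subtype.val_injective.injOn).subset fun _ hq => hq

/-- **Rows of the second variation are summable**: for a finitely supported `u` and a site `p`, the
family `q ↦ [p ≠ q] Hess₀ (p − q) (u p − u q)` is summable over the sites (it differs from the frozen row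
`w = u p` only on the finite support of `u`). [folklore] -/
theorem summable_hessRow (hA : Adm₀ A) (hI : Inner₀ t A) {u : (EuclideanSpace ℝ (Fin 3)) → (EuclideanSpace ℝ (Fin 3))}
    (hu : (Function.support u).Finite) (p : Sites₀ t A) :
    Summable (fun q : Sites₀ t A =>
      if (p : (EuclideanSpace ℝ (Fin 3))) ≠ q then Hess₀ ((p : (EuclideanSpace ℝ (Fin 3))) - q) (u p - u q) else 0) := by
  classical
  set T := (finite_support_sites (t := t) (A := A) hu).toFinset with hT
  have hG := summable_hess_frozen hA hI p (u p)
  have hD : Summable (fun q : Sites₀ t A =>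
      (if (p : (EuclideanSpace ℝ (Fin 3))) ≠ q then Hess₀ ((p : (EuclideanSpace ℝ (Fin 3))) - q) (u p - u q) else 0) -
        (if (p : (EuclideanSpace ℝ (Fin 3))) ≠ q then Hess₀ ((p : (EuclideanSpace ℝ (Fin 3))) - q) (u p) else 0)) := by
    refine summable_of_ne_finset_zero (s := T) fun q hq => ?_
    have huq : u q = 0 := by
      by_contra h
      exact hq ((Set.Finite.mem_toFinset _).2 h)
    simp [huq]
  convert hG.add hD using 1
  funext q
  ring

/-- **The outer family of the second variation is summable**: `p ↦ Σ'_q [p ≠ q] Hess₀ (p−q) (u p − u q)`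
is summable over the sites for finitely supported `u` (off the support of `u` the row reduces to the
finite sum `Σ_{q ∈ supp u} Hess₀ (p − q) (u q)`, a finite sum of summable columns). [folklore] -/
theorem summable_hessRows (hA : Adm₀ A) (hI : Inner₀ t A) {u : (EuclideanSpace ℝ (Fin 3)) → (EuclideanSpace ℝ (Fin 3))}
    (hu : (Function.support u).Finite) :
    Summable (fun p : Sites₀ t A => ∑' q : Sites₀ t A,
      if (p : (EuclideanSpace ℝ (Fin 3))) ≠ q then Hess₀ ((p : (EuclideanSpace ℝ (Fin 3))) - q) (u p - u q) else 0) := by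
  classical
  set T := (finite_support_sites (t := t) (A := A) hu).toFinset with hT
  have hmemT : ∀ q : Sites₀ t A, q ∉ T → u q = 0 := by
    intro q hq
    by_contra h
    exact hq ((Set.Finite.mem_toFinset _).2 h)
  -- the finite sum of frozen columns
  set H : Sites₀ t A → ℝ := fun p => ∑ q ∈ T, if (p : (EuclideanSpace ℝ (Fin 3))) ≠ q then Hess₀ ((p : (EuclideanSpace ℝ (Fin 3))) - q) (u q) else 0
    with hH
  have hHs : Summable H := summable_sum fun q _ => summable_hess_frozen' hA hI q (u q)
  -- off `T` the row is `H`
  have hrow : ∀ p : Sites₀ t A, p ∉ T →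
      (∑' q : Sites₀ t A, if (p : (EuclideanSpace ℝ (Fin 3))) ≠ q then Hess₀ ((p : (EuclideanSpace ℝ (Fin 3))) - q) (u p - u q) else 0) = H p := by
    intro p hp
    have hup : u p = 0 := hmemT p hp
    have hzero : ∀ q : Sites₀ t A, q ∉ T →
        (if (p : (EuclideanSpace ℝ (Fin 3))) ≠ q then Hess₀ ((p : (EuclideanSpace ℝ (Fin 3))) - q) (u p - u q) else 0) = 0 := by
      intro q hq
      simp [hup, hmemT q hq]
    rw [tsum_eq_sum hzero, hH]
    refine Finset.sum_congr rfl fun q _ => ?_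
    simp [hup, Hess₀_neg_right]
  have hD : Summable (fun p : Sites₀ t A =>
      (∑' q : Sites₀ t A, if (p : (EuclideanSpace ℝ (Fin 3))) ≠ q then Hess₀ ((p : (EuclideanSpace ℝ (Fin 3))) - q) (u p - u q) else 0) - H p) := by
    refine summable_of_ne_finset_zero (s := T) fun p hp => ?_
    rw [hrow p hp, sub_self]
  convert hHs.add hD using 1
  funext p
  ring

/-- The sites within `11/10` of a given point form a finite set of the site type. [folklore] -/
theorem finite_sites_near (hA : Adm₀ A) (hI : Inner₀ t A) (x : (EuclideanSpace ℝ (Fin 3))) :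
    Set.Finite {q : Sites₀ t A | dist x (q : (EuclideanSpace ℝ (Fin 3))) ≤ 11 / 10} := by
  refine ((finite_sites_dist_le hA hI x (11 / 10)).preimage Subtype.val_injective.injOn).subset ?_
  intro q hq
  simp only [Set.mem_setOf_eq] at hq
  simp only [Set.mem_preimage, Set.mem_setOf_eq]
  exact ⟨q.2, by rwa [dist_comm]⟩

/-- Rows of the nearest-neighbour strain form have finite support (finitely many sites within `11/10` of
a site), hence are summable. [folklore] -/
theorem summable_nnRow (hA : Adm₀ A) (hI : Inner₀ t A) (u : (EuclideanSpace ℝ (Fin 3)) → (EuclideanSpace ℝ (Fin 3))) (p : Sites₀ t A) :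
    Summable (fun q : Sites₀ t A =>
      if dist (p : (EuclideanSpace ℝ (Fin 3))) q ≤ 11 / 10 then ‖u p - u q‖ ^ 2 else 0) := by
  classical
  refine summable_of_ne_finset_zero (s := (finite_sites_near hA hI (p : (EuclideanSpace ℝ (Fin 3)))).toFinset) fun q hq => ?_
  have hfar : ¬ dist (p : (EuclideanSpace ℝ (Fin 3))) q ≤ 11 / 10 := fun h => hq ((Set.Finite.mem_toFinset _).2 h)
  rw [if_neg hfar]

/-- **The outer family of the nearest-neighbour strain form is summable** (indeed finitely supported:
off the support of `u` a row is nonzero only within `11/10` of the support). [folklore] -/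
theorem summable_nnRows (hA : Adm₀ A) (hI : Inner₀ t A) {u : (EuclideanSpace ℝ (Fin 3)) → (EuclideanSpace ℝ (Fin 3))}
    (hu : (Function.support u).Finite) :
    Summable (fun p : Sites₀ t A => ∑' q : Sites₀ t A,
      if dist (p : (EuclideanSpace ℝ (Fin 3))) q ≤ 11 / 10 then ‖u p - u q‖ ^ 2 else 0) := by
  classical
  set T := (finite_support_sites (t := t) (A := A) hu).toFinset with hT
  have hmemT : ∀ q : Sites₀ t A, q ∉ T → u q = 0 := by
    intro q hq
    by_contra h
    exact hq ((Set.Finite.mem_toFinset _).2 h)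
  have hN : Set.Finite (⋃ q ∈ (T : Set (Sites₀ t A)), {p : Sites₀ t A | dist (q : (EuclideanSpace ℝ (Fin 3))) (p : (EuclideanSpace ℝ (Fin 3))) ≤ 11 / 10}) :=
    T.finite_toSet.biUnion fun q _ => finite_sites_near hA hI (q : (EuclideanSpace ℝ (Fin 3)))
  refine summable_of_ne_finset_zero (s := T ∪ hN.toFinset) fun p hp => ?_
  rw [Finset.notMem_union] at hp
  have hup : u p = 0 := hmemT p hp.1
  have hfar : ∀ q : Sites₀ t A, q ∈ T → ¬ dist (p : (EuclideanSpace ℝ (Fin 3))) q ≤ 11 / 10 := by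
    intro q hq hd
    refine hp.2 ((Set.Finite.mem_toFinset _).2 ?_)
    simp only [Set.mem_iUnion, Set.mem_setOf_eq]
    exact ⟨q, hq, by rwa [dist_comm]⟩
  have hzero : ∀ q : Sites₀ t A,
      (if dist (p : (EuclideanSpace ℝ (Fin 3))) q ≤ 11 / 10 then ‖u p - u q‖ ^ 2 else 0) = 0 := by
    intro q
    by_cases hq : q ∈ T
    · rw [if_neg (hfar q hq)]
    · simp [hup, hmemT q hq]
  simp only [hzero, tsum_zero]

end Sites

end Summit.AtomisticToContinuum.Crystallization.Theorems.ExcessDecayLiouville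

end
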